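import Mathlib
import HarnessLib
import Summits.HubbardSuperconductivity.HubbardSuperconductivity.Theorems.KLProgrammeKLRegimeVolumeLimitGenericStubs

/-!
# VL children — the weakest carrier export: ONE MATSUBARA LABEL AT A TIME, each label with its OWN volume threshold and its own rate
# (cell gate-hubbard-kl, seat hubbard-kl-k3c5-p3 g5, gen-6 co-registrant of the VL child; `--supports` stmt-…-19921)

`carrierRateText_of_perLabelNested` (`…VolumeLimitPerLabel`, p503164) accepts label-dependent RATES `ρ n` but a COMMON volume threshold `L₀`.  A per-label proof
naturally comes with a per-label threshold `L₀(n)` as well.  Since the cutoff-free bare carrier is bounded uniformly in the volume for every real `U ≠ 0`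
(`Σ∞⁰ = U·occ∞ + U²·Six∞`, `‖occ∞‖ ≤ 3/2`, `‖Six∞‖ ≤ 9β/4` — k3c5-p1/k3c5-p3, all-`U`), the volumes below `L₀(n)` are absorbed into the rate
(`ρ′ n L := 2·B` there), so the threshold may depend on the label too:

* `norm_klSelfEnergyInf_zero_le` — `‖Σ∞⁰_L(n,p)‖ ≤ (3/2)|U| + (9/4)βU²` (`L ≥ 3`, `β > 0`, `U ≠ 0`);
* `carrierRateText_of_perLabelThresholds (Pr W)` — the carrier-export text of a VL child (= registered «cauchy» v3/v4 `stub_vl_carrierRate` at the bundle of record) from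
  (Nₙ″) `∀ n, ∃ L₀ ρ, ρ → 0 ∧ ∀ L ≥ L₀, L ∣ L″ ⇒ ∃ M₀ ∀ M ≥ M₀ ∀ ω, matsubaraInt M ω = n → p_{k″} = p_k → ‖Σ̂⁰_{L,M}(ω,k) − Σ̂⁰_{L″,M}(ω,k″)‖ ≤ ρ L`
  + (M) the one-volume modulus;
* `volumeLimitP2_of_perLabelThresholdsText (Pr W) hPr` — the child itself.

Everything is proved; no definition; nothing is asserted about the model.
-/

noncomputable section

namespace Summit.HubbardSuperconductivity.HubbardSuperconductivity.Theorems.TwoPointAssembly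

set_option linter.dupNamespace false -- summit = problem name (single-conjunct summit), D-0017

open Finset Filter Topology Literature.MathematicalPhysics.QuantumLattice Literature.Probability.LatticeModels
open Literature.MathematicalPhysics.QuantumLattice.FermiRG
open Summit.HubbardSuperconductivity.HubbardSuperconductivity.Theorems.DispersionFlow
open Summit.HubbardSuperconductivity.HubbardSuperconductivity.Theorems.KLRegimeSplit
open Summit.HubbardSuperconductivity.HubbardSuperconductivity.Theorems.KLProgrammeLegKernels
open Summit.HubbardSuperconductivity.HubbardSuperconductivity.Theorems.KLRegimeVolumeLimit (kler_carrierRate_of_sameCutoff)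

/-! ## §1 The cutoff-free bare carrier is bounded uniformly in the volume (every `U ≠ 0`) -/

/-- `‖Σ∞⁰_L(n,p)‖ ≤ (3/2)|U| + (9/4)βU²` for `L ≥ 3`, `β > 0`, `U ≠ 0` (Hartree term `‖occ∞‖ ≤ 3/2`, six-point term `‖Six∞‖ ≤ 9β/4`). -/
theorem norm_klSelfEnergyInf_zero_le {L : ℕ} [NeZero L] (hL : 3 ≤ L) {β : ℝ} (hβ : 0 < β) {U : ℝ} (hU : U ≠ 0) (μ : ℝ) (n : ℤ)
    (p : TorusSite 2 L) : ‖klSelfEnergyInf L β U μ 0 n p‖ ≤ 3 / 2 * |U| + 9 / 4 * β * U ^ 2 := by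
  rw [klSelfEnergyInf_zero_frame hβ.ne' U μ n p]
  refine (norm_add_le _ _).trans (add_le_add ?_ ?_)
  · rw [norm_mul, Complex.norm_real, Real.norm_eq_abs]
    have h := norm_klOccInf_le (L := L) β U μ
    calc |U| * ‖klOccInf L β U μ‖ ≤ |U| * (3 / 2) := mul_le_mul_of_nonneg_left h (abs_nonneg U)
      _ = 3 / 2 * |U| := by ring
  · rw [norm_mul, norm_pow, Complex.norm_real, Real.norm_eq_abs, sq_abs]
    have h := norm_klSixInf_le_beta hL hβ hU μ n p
    calc U ^ 2 * ‖klSixInf L β U μ n p‖ ≤ U ^ 2 * (9 / 4 * β) := mul_le_mul_of_nonneg_left h (sq_nonneg U)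
      _ = 9 / 4 * β * U ^ 2 := by ring

/-! ## §2 Per-label rates AND per-label thresholds suffice -/

/-- **THE WEAKEST EXPORT: one label at a time, each with its own threshold and rate.**  The carrier-export text of a VL child (any bundle `Pr`, window `W`)
from (Nₙ″) — for EACH Matsubara integer `n`: `∃ L₀ ρ, ρ → 0`, nested same-momentum comparability at a common cutoff beyond `L₀` — and (M) the one-volume modulus. -/
theorem carrierRateText_of_perLabelThresholds (Pr : Preds) (W : Set ℝ)
    (hN : ∀ (G : GeoConsts) (P : SplitConsts) (Q : EngConsts) (R : RenConsts), G.WF → P.WF → Q.WF → R.WF →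
      ∃ c₅ : ℝ, 0 < c₅ ∧ ∀ c : ℝ, 0 < c → c ≤ c₅ → ∃ U₀ : ℝ, 0 < U₀ ∧
        ∀ μ ∈ W, ∀ U : ℝ, 0 < U → U ≤ U₀ → ∀ β : ℝ, klBetaMin ≤ β → β ≤ Real.exp (c / U ^ 2) →
          ∀ K : TrigPolyC4v, Pr.frameOK R U (nScales β) μ K →
            ∀ (Lstar : ℕ) (Mstar : ℕ → ℕ), TowerP Pr G P Q R β U μ K Lstar Mstar →
              ∀ n : ℤ, ∃ L₀ : ℕ, ∃ ρ : ℕ → ℝ, Tendsto ρ atTop (𝓝 0) ∧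
                ∀ (L : ℕ) [NeZero L], L₀ ≤ L → ∀ (L'' : ℕ) [NeZero L''], L ∣ L'' → ∃ M₀ : ℕ, ∀ (M : ℕ) [NeZero M], M₀ ≤ M →
                  ∀ (ω : MatsubaraIdx M), matsubaraInt M ω = n → ∀ (k : TorusSite 2 L) (k'' : TorusSite 2 L''),
                    latticeMomentum L'' k'' = latticeMomentum L k →
                      ‖klSelfEnergy L M β U μ 0 klE0 (nScales β + 1) (ω, k) 0 -
                          klSelfEnergy L'' M β U μ 0 klE0 (nScales β + 1) (ω, k'') 0‖ ≤ ρ L)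
    (hM : ∀ (G : GeoConsts) (P : SplitConsts) (Q : EngConsts) (R : RenConsts), G.WF → P.WF → Q.WF → R.WF →
      ∃ c₅ : ℝ, 0 < c₅ ∧ ∀ c : ℝ, 0 < c → c ≤ c₅ → ∃ U₀ : ℝ, 0 < U₀ ∧
        ∀ μ ∈ W, ∀ U : ℝ, 0 < U → U ≤ U₀ → ∀ β : ℝ, klBetaMin ≤ β → β ≤ Real.exp (c / U ^ 2) →
          ∀ K : TrigPolyC4v, Pr.frameOK R U (nScales β) μ K →
            ∀ (Lstar : ℕ) (Mstar : ℕ → ℕ), TowerP Pr G P Q R β U μ K Lstar Mstar →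
              ∃ L₀ : ℕ, ∃ D : ℝ, ∃ ρ' : ℕ → ℝ, Tendsto ρ' atTop (𝓝 0) ∧
                ∀ (L : ℕ) [NeZero L], L₀ ≤ L → ∃ M₀ : ℕ, ∀ (M : ℕ) [NeZero M], M₀ ≤ M →
                  ∀ (ω : MatsubaraIdx M) (k₁ k₂ : TorusSite 2 L),
                    ‖klSelfEnergy L M β U μ 0 klE0 (nScales β + 1) (ω, k₁) 0 -
                        klSelfEnergy L M β U μ 0 klE0 (nScales β + 1) (ω, k₂) 0‖ ≤
                      ρ' L + D * ∑ i, torusAbs (latticeMomentum L k₁ i - latticeMomentum L k₂ i)) :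
    ∀ (G : GeoConsts) (P : SplitConsts) (Q : EngConsts) (R : RenConsts), G.WF → P.WF → Q.WF → R.WF →
      ∃ c₅ : ℝ, 0 < c₅ ∧ ∀ c : ℝ, 0 < c → c ≤ c₅ → ∃ U₀ : ℝ, 0 < U₀ ∧
        ∀ μ ∈ W, ∀ U : ℝ, 0 < U → U ≤ U₀ → ∀ β : ℝ, klBetaMin ≤ β → β ≤ Real.exp (c / U ^ 2) →
          ∀ K : TrigPolyC4v, Pr.frameOK R U (nScales β) μ K →
            ∀ (Lstar : ℕ) (Mstar : ℕ → ℕ), TowerP Pr G P Q R β U μ K Lstar Mstar →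
              ∃ L₀ : ℕ, ∃ D : ℝ, ∃ ρ : ℕ → ℝ, Tendsto ρ atTop (𝓝 0) ∧
                ∀ (L : ℕ) [NeZero L], L₀ ≤ L → ∀ (L' : ℕ) [NeZero L'], L ≤ L' → ∃ M₀ : ℕ, ∀ (M : ℕ) [NeZero M], M₀ ≤ M →
                  ∀ (ω : MatsubaraIdx M) (k : TorusSite 2 L) (k' : TorusSite 2 L'),
                    ‖klSelfEnergy L M β U μ 0 klE0 (nScales β + 1) (ω, k) 0 -
                        klSelfEnergy L' M β U μ 0 klE0 (nScales β + 1) (ω, k') 0‖ ≤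
                      ρ L + D * ∑ i, torusAbs (latticeMomentum L k i - latticeMomentum L' k' i) := by
  classical
  intro G P Q R hG hP hQ hR
  obtain ⟨c₁, hc₁, h₁⟩ := hN G P Q R hG hP hQ hR
  obtain ⟨c₂, hc₂, h₂⟩ := hM G P Q R hG hP hQ hR
  refine ⟨min c₁ c₂, lt_min hc₁ hc₂, fun c hc hcle => ?_⟩
  obtain ⟨U₁, hU₁, h₁'⟩ := h₁ c hc (hcle.trans (min_le_left _ _))
  obtain ⟨U₂, hU₂, h₂'⟩ := h₂ c hc (hcle.trans (min_le_right _ _))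
  refine ⟨min U₁ U₂, lt_min hU₁ hU₂, ?_⟩
  intro μ hμ U hU hUle β hβ hβle K hK Lstar Mstar hT
  have hβ0 : 0 < β := pos_of_klBetaMin_le hβ
  have hU0 : U ≠ 0 := hU.ne'
  have hper := h₁' μ hμ U hU (hUle.trans (min_le_left _ _)) β hβ hβle K hK Lstar Mstar hT
  choose L0n ρn hρn hnest using hper
  obtain ⟨L₂, D, ρ', hρ', hmod⟩ := h₂' μ hμ U hU (hUle.trans (min_le_right _ _)) β hβ hβle K hK Lstar Mstar hT
  set L₀ : ℕ := max L₂ 3 with hL₀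
  have hL₀3 : 3 ≤ L₀ := le_max_right _ _
  -- the volume-uniform bound of the cutoff-free bare carrier
  set Bc : ℝ := 3 / 2 * |U| + 9 / 4 * β * U ^ 2 with hBc
  -- (1) per label: cutoff-free comparability beyond the label's own threshold, `2·Bc` below it
  obtain ⟨ρn', hρn'def⟩ : ∃ f : ℤ → ℕ → ℝ, ∀ n L, f n L = if L0n n ≤ L then ρn n L else 2 * Bc := ⟨_, fun _ _ => rfl⟩
  have hρn' : ∀ n, Tendsto (ρn' n) atTop (𝓝 0) := by
    intro n
    refine (hρn n).congr' ?_
    filter_upwards [eventually_ge_atTop (L0n n)] with L hL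
    rw [hρn'def, if_pos hL]
  have hinfN : ∀ (n : ℤ) (L : ℕ) [NeZero L], L₀ ≤ L → ∀ (L'' : ℕ) [NeZero L''], L ∣ L'' →
      ∀ (k : TorusSite 2 L) (k'' : TorusSite 2 L''), latticeMomentum L'' k'' = latticeMomentum L k →
        ‖klSelfEnergyInf L β U μ 0 n k - klSelfEnergyInf L'' β U μ 0 n k''‖ ≤ ρn' n L := by
    intro n L _ hL L'' _ hdvd k k'' hkk
    have hL3 : 3 ≤ L := hL₀3.trans hL
    have hL3'' : 3 ≤ L'' := hL3.trans (Nat.le_of_dvd (Nat.pos_of_ne_zero (NeZero.ne L'')) hdvd)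
    by_cases hLn : L0n n ≤ L
    · rw [hρn'def, if_pos hLn]
      obtain ⟨M₀, hM₀⟩ := hnest n L hLn L'' hdvd
      exact kler_carrierRate_of_sameCutoff hβ0 U μ 0 hL3 hL3'' ⟨M₀, fun M _ hMM ω hω => hM₀ M hMM ω hω k k'' hkk⟩
    · rw [hρn'def, if_neg hLn]
      calc ‖klSelfEnergyInf L β U μ 0 n k - klSelfEnergyInf L'' β U μ 0 n k''‖
          ≤ ‖klSelfEnergyInf L β U μ 0 n k‖ + ‖klSelfEnergyInf L'' β U μ 0 n k''‖ := norm_sub_le _ _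
        _ ≤ Bc + Bc := add_le_add (norm_klSelfEnergyInf_zero_le hL3 hβ0 hU0 μ n k) (norm_klSelfEnergyInf_zero_le hL3'' hβ0 hU0 μ n k'')
        _ = 2 * Bc := by ring
  -- (2) per-label rates become one label-uniform rate
  obtain ⟨ρu, hρu, hnestU⟩ := nestedRateInf_uniform_of_perLabel hβ0 U μ hL₀3 hρn' hinfN
  -- (3) the modulus, cutoff-free
  have hmodInf : ∀ (L : ℕ) [NeZero L], L₀ ≤ L → ∀ (n : ℤ) (k₁ k₂ : TorusSite 2 L),
      ‖klSelfEnergyInf L β U μ 0 n k₁ - klSelfEnergyInf L β U μ 0 n k₂‖ ≤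
        ρ' L + D * ∑ i, torusAbs (latticeMomentum L k₁ i - latticeMomentum L k₂ i) := by
    intro L _ hL n k₁ k₂
    have hL3 : 3 ≤ L := hL₀3.trans hL
    obtain ⟨M₀, hM₀⟩ := hmod L ((le_max_left _ _).trans hL)
    exact kler_carrierRate_of_sameCutoff hβ0 U μ 0 hL3 hL3 ⟨M₀, fun M _ hMM ω _ => hM₀ M hMM ω k₁ k₂⟩
  -- (4) nested + modulus ⇒ arbitrary pairs (cutoff-free), then back to finite cutoff
  obtain ⟨ρ₂, hρ₂, hpair⟩ := twoVolumeRate_of_nestedRate (T := fun L _ n k => klSelfEnergyInf L β U μ 0 n k) (L₀ := L₀) (D := D)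
    hρu hρ' (fun L _ hL L'' _ hdvd n k k'' hkk => hnestU L hL L'' hdvd n k k'' hkk) (fun L _ hL n k₁ k₂ => hmodInf L hL n k₁ k₂)
  obtain ⟨L₃, Mth, D', ρ₃, hρ₃, hrate⟩ := twoVolumeRate_of_cutoffFreeRate hβ0 U μ 0 hρ₂ hpair
  refine ⟨L₃, D', ρ₃, hρ₃, fun L _ hL L' _ hLL' => ⟨max (Mth L) (Mth L'), fun M _ hMM ω k k' => ?_⟩⟩
  exact hrate L hL M (le_of_max_le_left hMM) L' hLL' M (le_of_max_le_right hMM) 0 ω ω rfl k k'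

/-- **A VL child (any `Pr`, `W`) from the weakest export**: per-label nested comparability with per-label thresholds and rates + the one-volume modulus. -/
theorem volumeLimitP2_of_perLabelThresholdsText (Pr : Preds) (W : Set ℝ)
    (hPr : ∀ (R : RenConsts) (U : ℝ) (N : ℕ) (μ : ℝ) (K : TrigPolyC4v), Pr.frameOK R U N μ K → FrameOK R U N μ K)
    (hN : ∀ (G : GeoConsts) (P : SplitConsts) (Q : EngConsts) (R : RenConsts), G.WF → P.WF → Q.WF → R.WF →
      ∃ c₅ : ℝ, 0 < c₅ ∧ ∀ c : ℝ, 0 < c → c ≤ c₅ → ∃ U₀ : ℝ, 0 < U₀ ∧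
        ∀ μ ∈ W, ∀ U : ℝ, 0 < U → U ≤ U₀ → ∀ β : ℝ, klBetaMin ≤ β → β ≤ Real.exp (c / U ^ 2) →
          ∀ K : TrigPolyC4v, Pr.frameOK R U (nScales β) μ K →
            ∀ (Lstar : ℕ) (Mstar : ℕ → ℕ), TowerP Pr G P Q R β U μ K Lstar Mstar →
              ∀ n : ℤ, ∃ L₀ : ℕ, ∃ ρ : ℕ → ℝ, Tendsto ρ atTop (𝓝 0) ∧
                ∀ (L : ℕ) [NeZero L], L₀ ≤ L → ∀ (L'' : ℕ) [NeZero L''], L ∣ L'' → ∃ M₀ : ℕ, ∀ (M : ℕ) [NeZero M], M₀ ≤ M →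
                  ∀ (ω : MatsubaraIdx M), matsubaraInt M ω = n → ∀ (k : TorusSite 2 L) (k'' : TorusSite 2 L''),
                    latticeMomentum L'' k'' = latticeMomentum L k →
                      ‖klSelfEnergy L M β U μ 0 klE0 (nScales β + 1) (ω, k) 0 -
                          klSelfEnergy L'' M β U μ 0 klE0 (nScales β + 1) (ω, k'') 0‖ ≤ ρ L)
    (hM : ∀ (G : GeoConsts) (P : SplitConsts) (Q : EngConsts) (R : RenConsts), G.WF → P.WF → Q.WF → R.WF →
      ∃ c₅ : ℝ, 0 < c₅ ∧ ∀ c : ℝ, 0 < c → c ≤ c₅ → ∃ U₀ : ℝ, 0 < U₀ ∧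
        ∀ μ ∈ W, ∀ U : ℝ, 0 < U → U ≤ U₀ → ∀ β : ℝ, klBetaMin ≤ β → β ≤ Real.exp (c / U ^ 2) →
          ∀ K : TrigPolyC4v, Pr.frameOK R U (nScales β) μ K →
            ∀ (Lstar : ℕ) (Mstar : ℕ → ℕ), TowerP Pr G P Q R β U μ K Lstar Mstar →
              ∃ L₀ : ℕ, ∃ D : ℝ, ∃ ρ' : ℕ → ℝ, Tendsto ρ' atTop (𝓝 0) ∧
                ∀ (L : ℕ) [NeZero L], L₀ ≤ L → ∃ M₀ : ℕ, ∀ (M : ℕ) [NeZero M], M₀ ≤ M →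
                  ∀ (ω : MatsubaraIdx M) (k₁ k₂ : TorusSite 2 L),
                    ‖klSelfEnergy L M β U μ 0 klE0 (nScales β + 1) (ω, k₁) 0 -
                        klSelfEnergy L M β U μ 0 klE0 (nScales β + 1) (ω, k₂) 0‖ ≤
                      ρ' L + D * ∑ i, torusAbs (latticeMomentum L k₁ i - latticeMomentum L k₂ i)) :
    VolumeLimitP2 Pr FinalTwoLegVolLimitEx W :=
  volumeLimitP2_of_carrierText Pr W hPr (carrierRateText_of_perLabelThresholds Pr W hN hM)

end Summit.HubbardSuperconductivity.HubbardSuperconductivity.Theorems.TwoPointAssembly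

end
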